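import Mathlib
import HarnessLib
import Summits.FinalStateConjecture.Statement
import Literature.Geometry.Lorentzian.LandauLifshitzPseudotensor
import Literature.Barriers.FinalStateConjecture.ExtremalHorizonChargeConservationProofs
import Summits.FinalStateConjecture.FinalStateConjecture.Theorems.EIHFluxBalanceInertialRecessionStubChargeModelKSMatrix
import Literature.Geometry.Lorentzian.SchwarzschildKerrSchildComponents

/-!
# Route EIHFluxBalance — `InertialRecession`, line `sublinear-is-free-clean-window-charges`:
# the Landau–Lifshitz momentum density of the static Schwarzschild Kerr–Schild field
# (helpers for `stub_chargeModel`, identification half)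

Helper file (`--supports stmt-FinalStateConjecture-10166`) for the crux
`Summit.FinalStateConjecture.FinalStateConjecture.Theses.EIHFluxBalance.InertialRecession`.

For the Schwarzschild metric in Kerr–Schild form `g_{M,0} = η + (2M/r) ℓ ⊗ ℓ` (`ℓ = (1, x~/r)`, so
`det g = −1`, `g^{μν} = η^{μν} − (2M/r) ℓ^μ ℓ^ν`, `…KSMatrix`) we compute, off the time axis:

* `superpotential_schwarzschild_time` — the components of the LL superpotential entering the energy,
  `H^{0i0j} = −(1 + 2M/r) δ_{ij} + 2M xᵢxⱼ/r³` and `H^{000j} = 0`;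
* `hField_schwarzschild_energy` — **the LL energy–momentum density of the energy flux**,
  `h^{00j}(x) = M xⱼ / (4π r³)` (LL §96, (96.2)–(96.3) evaluated on (105.x)): on every coordinate sphere
  about the hole `Σⱼ h^{00j} nⱼ = M/(4πR²)`, so the quasi-local energy of every such sphere is exactly `M`.
-/

set_option linter.dupNamespace false
-- instance search on the nested operator spaces needs a deeper pending depth (as in `CoordCurvature.lean`)
set_option maxSynthPendingDepth 3

noncomputable section

open scoped Matrix BigOperators Topology
open Filter Set Literature.Geometry.Lorentzian Literature.Geometry.Lorentzian.LandauLifshitz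

namespace Summit.FinalStateConjecture.FinalStateConjecture.Theorems

namespace KSCharge

/-- Off the time axis the Kerr–Schild radius at `a = 0` is positive. [folklore] -/
theorem radius_pos_of_spatial_ne_zero {x : E4} (hx : E4.spatial x ≠ 0) : 0 < Kerr.radius 0 x := by
  rw [Kerr.radius_zero_left, E4.spatialNorm]
  exact norm_pos_iff.2 hx

/-- The Kerr–Schild covector at `a = 0` in components: `ℓ = (1, x₁/r, x₂/r, x₃/r)`. [cite: KerrSchild1965] -/
theorem nullCovectorFun_zero_spin {x : E4} (hx : E4.spatial x ≠ 0) :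
    Kerr.nullCovectorFun 0 x = ![1, x 1 / E4.spatialNorm x, x 2 / E4.spatialNorm x, x 3 / E4.spatialNorm x] := by
  have hr : E4.spatialNorm x ≠ 0 := by
    rw [E4.spatialNorm]; exact norm_ne_zero_iff.2 hx
  unfold Kerr.nullCovectorFun
  rw [Kerr.radius_zero_left]
  funext μ
  fin_cases μ <;> simp <;> field_simp

/-- **The inverse components of the Schwarzschild Kerr–Schild form, entrywise**:
`g^{μν}(x) = η^{μν} − (2M/r) ℓ^μ ℓ^ν` with `ℓ^♯ = (−1, x~/r)`. [cite: KerrSchild1965] -/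
theorem upper_schwarzschild_apply (M : ℝ) {x : E4} (hx : E4.spatial x ≠ 0) (μ ν : Fin 4) :
    upper (fun y ↦ Kerr.bilin M 0 y) x μ ν =
      (Matrix.diagonal ![(-1 : ℝ), 1, 1, 1]) μ ν -
        2 * M / E4.spatialNorm x *
          (![-1, x 1 / E4.spatialNorm x, x 2 / E4.spatialNorm x, x 3 / E4.spatialNorm x] μ *
            ![-1, x 1 / E4.spatialNorm x, x 2 / E4.spatialNorm x, x 3 / E4.spatialNorm x] ν) := by
  have hr : E4.spatialNorm x ≠ 0 := by
    rw [E4.spatialNorm]; exact norm_ne_zero_iff.2 hx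
  rw [KSMatrix.upper_kerr M 0 (radius_pos_of_spatial_ne_zero hx), KSMatrix.mulVec_eta,
    nullCovectorFun_zero_spin hx, Kerr.scalarH_zero_spin M hr, Matrix.sub_apply, Matrix.smul_apply,
    Matrix.vecMulVec_apply, smul_eq_mul]
  congr 1
  simp only [Matrix.cons_val_zero, Matrix.cons_val_one, Matrix.cons_val]
  ring

/-- **The energy components of the LL superpotential of Schwarzschild**, off the time axis:
`H^{0i0j}(x) = −(1 + 2M/r) δ_{ij} + 2M xᵢ xⱼ / r³` (`i, j` spatial). [cite: LandauLifshitz1975, §96 (96.3)] -/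
theorem superpotential_schwarzschild_time (M : ℝ) {x : E4} (hx : E4.spatial x ≠ 0) (i j : Fin 3) :
    superpotential (fun y ↦ Kerr.bilin M 0 y) x 0 i.succ 0 j.succ =
      -(1 + 2 * M / E4.spatialNorm x) * (if i = j then 1 else 0) +
        2 * M * (x i.succ * x j.succ) / E4.spatialNorm x ^ 3 := by
  have hr : E4.spatialNorm x ≠ 0 := by
    rw [E4.spatialNorm]; exact norm_ne_zero_iff.2 hx
  rw [superpotential, KSMatrix.metricDet_kerr M 0 (radius_pos_of_spatial_ne_zero hx)]
  simp only [upper_schwarzschild_apply M hx]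
  fin_cases i <;> fin_cases j <;> simp [Matrix.diagonal] <;> field_simp <;> ring


/-! ### Derivatives of the superpotential components and the energy density `h^{00j}` -/

/-- Spatial pairing with a spatial coordinate vector: `⟪x~, (∂_{k+1})~⟫ = x_{k+1}`. [folklore] -/
theorem sdot_basisVector_succ (x : E4) (k : Fin 3) :
    Schwarzschild.sdot x (E4.basisVector k.succ) = x k.succ := by
  rw [Schwarzschild.sdot, Kerr.inner_spatial_eq]
  fin_cases k <;> simp [E4.basisVector]

/-- Coordinates of the coordinate vectors: `(∂_μ)^ν = δ_μ^ν`. [folklore] -/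
@[deprecated Literature.Barriers.FinalStateConjecture.Kerr.basisVector_apply (since := "2026-08-17")]
alias basisVector_apply := Literature.Barriers.FinalStateConjecture.Kerr.basisVector_apply

/-- **The derivative of the explicit superpotential component** `y ↦ −(1 + 2M/r)δᵢⱼ + 2M yᵢyⱼ/r³`
in the spatial coordinate direction `∂_{k+1}`, off the time axis:
`δᵢⱼ 2M x_k/r³ + (δᵢₖ xⱼ + xᵢ δⱼₖ) 2M/r³ − 6M xᵢxⱼx_k/r⁵`. [folklore] -/
theorem fderiv_superpotentialFun_apply (M : ℝ) {x : E4} (hx : E4.spatial x ≠ 0) (i j k : Fin 3) :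
    fderiv ℝ (fun y : E4 ↦ -(1 + 2 * M / E4.spatialNorm y ^ 1) * (if i = j then (1 : ℝ) else 0) +
        (y i.succ * y j.succ) * (2 * M / E4.spatialNorm y ^ 3)) x (E4.basisVector k.succ) =
      (if i = j then (1 : ℝ) else 0) * (2 * M * x k.succ / E4.spatialNorm x ^ 3) +
        ((if i = k then (1 : ℝ) else 0) * x j.succ + x i.succ * (if j = k then (1 : ℝ) else 0)) *
          (2 * M / E4.spatialNorm x ^ 3) -
        x i.succ * x j.succ * (6 * M * x k.succ / E4.spatialNorm x ^ 5) := by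
  have h₁ := Schwarzschild.hasFDerivAt_const_div_spatialNorm_pow (2 * M) hx 1
  have h₃ := Schwarzschild.hasFDerivAt_const_div_spatialNorm_pow (2 * M) hx 3
  have hc : ∀ m : Fin 4, HasFDerivAt (fun y : E4 ↦ y m) (EuclideanSpace.proj m : E4 →L[ℝ] ℝ) x := fun m ↦
    (EuclideanSpace.proj m : E4 →L[ℝ] ℝ).hasFDerivAt
  have hA := ((h₁.const_add 1).neg.mul_const (if i = j then (1 : ℝ) else 0))
  have hB := ((hc i.succ).mul (hc j.succ)).mul h₃
  have hS : HasFDerivAt (fun y : E4 ↦ -(1 + 2 * M / E4.spatialNorm y ^ 1) * (if i = j then (1 : ℝ) else 0) +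
      (y i.succ * y j.succ) * (2 * M / E4.spatialNorm y ^ 3)) _ x := hA.add hB
  rw [hS.fderiv]
  simp only [add_apply, smul_apply, neg_apply, smul_eq_mul, Schwarzschild.sdotCLM_apply,
    sdot_basisVector_succ, Pi.mul_apply]
  have hp : ∀ m : Fin 4, (EuclideanSpace.proj m : E4 →L[ℝ] ℝ) (E4.basisVector k.succ) =
      if m = k.succ then 1 else 0 := fun m ↦ by
    rw [show (EuclideanSpace.proj m : E4 →L[ℝ] ℝ) (E4.basisVector k.succ) = E4.basisVector k.succ m from rfl,
      Literature.Barriers.FinalStateConjecture.Kerr.basisVector_apply]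
  rw [hp, hp]
  have hik : (i.succ = k.succ) = (i = k) := by rw [Fin.succ_inj]
  have hjk : (j.succ = k.succ) = (j = k) := by rw [Fin.succ_inj]
  simp only [hik, hjk]
  ring

/-- The contraction `Σᵢ ∂ᵢ H^{0i0j}` of the explicit superpotential: `4M xⱼ / r³`. [folklore] -/
theorem sum_fderiv_superpotentialFun (M : ℝ) {x : E4} (hx : E4.spatial x ≠ 0) (j : Fin 3) :
    ∑ i : Fin 3, fderiv ℝ (fun y : E4 ↦ -(1 + 2 * M / E4.spatialNorm y ^ 1) * (if i = j then (1 : ℝ) else 0) +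
        (y i.succ * y j.succ) * (2 * M / E4.spatialNorm y ^ 3)) x (E4.basisVector i.succ) =
      4 * M * x j.succ / E4.spatialNorm x ^ 3 := by
  have hr : E4.spatialNorm x ≠ 0 := by
    rw [E4.spatialNorm]; exact norm_ne_zero_iff.2 hx
  have hsq := E4.spatialNorm_sq x
  simp only [fderiv_superpotentialFun_apply M hx]
  rw [Fin.sum_univ_three]
  fin_cases j
  · simp
    field_simp
    linear_combination 6 * M * x 1 * hsq
  · simp
    field_simp
    linear_combination 6 * M * x 2 * hsq
  · simp
    field_simp
    linear_combination 6 * M * x 3 * hsq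


/-- **The Landau–Lifshitz energy flux density of the static Schwarzschild Kerr–Schild field**:
off the time axis, `h^{00j}(x) = M xⱼ / (4π r³)` (LL (96.2)–(96.3) on the Kerr–Schild components:
`Σᵢ ∂ᵢ H^{0i0j} = 4M xⱼ/r³`, `H^{000j} = 0`). Consequently `Σⱼ h^{00j} nⱼ = M/(4πR²)` on the coordinate
sphere of radius `R` about the hole, whose quasi-local energy is therefore exactly `M`.
[cite: LandauLifshitz1975, §96 (96.2)] -/
theorem hField_schwarzschild_energy (M : ℝ) {x : E4} (hx : E4.spatial x ≠ 0) (j : Fin 3) :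
    hField (fun y ↦ Kerr.bilin M 0 y) x 0 0 j.succ = M * x j.succ / (4 * Real.pi * E4.spatialNorm x ^ 3) := by
  have hr : E4.spatialNorm x ≠ 0 := by
    rw [E4.spatialNorm]; exact norm_ne_zero_iff.2 hx
  rw [hField, Fin.sum_univ_succ]
  have h0 : (fun y ↦ superpotential (fun y ↦ Kerr.bilin M 0 y) y 0 0 0 j.succ) = fun _ ↦ (0 : ℝ) :=
    funext fun y ↦ superpotential_self_left _ y 0 0 j.succ
  have hi : ∀ i : Fin 3, partialDeriv i.succ (fun y ↦ superpotential (fun y ↦ Kerr.bilin M 0 y) y 0 i.succ 0 j.succ) x =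
      fderiv ℝ (fun y : E4 ↦ -(1 + 2 * M / E4.spatialNorm y ^ 1) * (if i = j then (1 : ℝ) else 0) +
        (y i.succ * y j.succ) * (2 * M / E4.spatialNorm y ^ 3)) x (E4.basisVector i.succ) := by
    intro i
    rw [partialDeriv]
    congr 1
    refine Filter.EventuallyEq.fderiv_eq ?_
    filter_upwards [Schwarzschild.isOpen_spatial_ne_zero.mem_nhds hx] with y hy
    rw [superpotential_schwarzschild_time M hy, pow_one]
    ring
  have h00 : partialDeriv 0 (fun y ↦ superpotential (fun y ↦ Kerr.bilin M 0 y) y 0 0 0 j.succ) x = 0 := by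
    rw [h0, partialDeriv, fderiv_const_apply]
    rfl
  rw [h00, zero_add]
  simp only [hi, sum_fderiv_superpotentialFun M hx]
  have hπ : Real.pi ≠ 0 := Real.pi_ne_zero
  field_simp
  ring

/-- On the coordinate sphere of radius `R` about the hole (in the slice `{x⁰ = t}`), the radial
energy flux density is the constant `M/(4πR²)`: `Σⱼ h^{00j}(t, y) yⱼ/R = M/(4πR²)` for `‖y‖ = R > 0`.
[cite: LandauLifshitz1975, §96 (96.16)] -/
theorem sum_hField_schwarzschild_energy_sphere (M t : ℝ) {R : ℝ} (hR : 0 < R) {y : E3} (hy : ‖y‖ = R) :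
    ∑ j : Fin 3, hField (fun z ↦ Kerr.bilin M 0 z) (E4.ofTimeSpace t y) 0 0 j.succ * (y - 0) j / R =
      M / (4 * Real.pi * R ^ 2) := by
  have hsp : E4.spatial (E4.ofTimeSpace t y) = y := E4.spatial_ofTimeSpace t y
  have hy0 : y ≠ 0 := by
    intro h; rw [h, norm_zero] at hy; exact hR.ne' hy.symm
  have hx : E4.spatial (E4.ofTimeSpace t y) ≠ 0 := by rwa [hsp]
  have hn : E4.spatialNorm (E4.ofTimeSpace t y) = R := by rw [E4.spatialNorm_ofTimeSpace, hy]
  simp only [hField_schwarzschild_energy M hx, hn, sub_zero, E4.ofTimeSpace_apply_succ]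
  have hsq : y 0 ^ 2 + y 1 ^ 2 + y 2 ^ 2 = R ^ 2 := by
    have h := EuclideanSpace.norm_sq_eq y
    rw [hy, Fin.sum_univ_three] at h
    simp only [Real.norm_eq_abs, sq_abs] at h
    linarith
  rw [Fin.sum_univ_three]
  have hπ : Real.pi ≠ 0 := Real.pi_ne_zero
  field_simp
  linear_combination M * hsq

end KSCharge

/-- Registered sub-goal form (stub `hField_schwarzschild_energy_density` of the crux item) of
`KSCharge.hField_schwarzschild_energy`: the LL energy flux density of the static Schwarzschild
Kerr–Schild field, `h^{00j} = M xⱼ/(4πr³)`. [cite: LandauLifshitz1975, §96 (96.2)] -/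
theorem hField_schwarzschild_energy_density : open Literature.Geometry.Lorentzian in ∀ (M : ℝ) {x : E4}, E4.spatial x ≠ 0 → ∀ j : Fin 3, LandauLifshitz.hField (fun y ↦ Kerr.bilin M 0 y) x 0 0 j.succ = M * x j.succ / (4 * Real.pi * E4.spatialNorm x ^ 3) :=
  fun M _ hx j ↦ KSCharge.hField_schwarzschild_energy M hx j

end Summit.FinalStateConjecture.FinalStateConjecture.Theorems

end
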